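import Summits.BirchSwinnertonDyer.BirchSwinnertonDyer.Theorems.ResidualThetaTransportAtTwoSignedMuSeedAtTwoPlusJetLevelTwoWallComplete
import HarnessLib

/-!
# The level-one wall is SHARPER than the card: `S₁ ≡ (ūT₄² + ū²T₆)·t¹² (mod t¹⁶)`, hence `[t⁴⁴]S₂ = 0` always
# (seed line `jet-character-sums`, J4/J5; crux `SignedMuSeedAtTwoPlus` stmt-BirchSwinnertonDyer-21438; Kμ⁺ stmt-BirchSwinnertonDyer-20689)

Cell `bsd-wall`, width seat `bsd-wall-rtt-p4-w2` g13 (`--supports`, closes nothing).  THEOREMS ONLY; the lines are NOT registered (W-79); BSD is not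
proved by this.

* `coeff_levelStep_belowThreshold'` — the closed form of p679704 with relaxed ranges (`e + 5 ≤ 4N + v`, `e ≤ 2N + 2v + 1`; no `N ≤ v + 2`).
* **`levelOne_wall_sharp`** — level `0 → 1` (`N = 4`, `S₀' = S₀²`, `T₀ = T₂ = 0`, `δ₀ = ūt⁴ + ct⁸ + t¹⁰ε'`): `[t¹⁴]S₁ = 0` and `[t¹⁵]S₁ = 0`
  (the card: «`S₁ ≡ (ūT₄² + ū²T₆)t¹² (mod t¹⁴)`»; kernel p678286: `mod t¹⁴`; here: `mod t¹⁶`, since `C(8,2), C(5,3), C(9,2), C(6,3)` are even and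
  `T₃ = T₅ = 0`).  Consequence with `levelTwo_wall` (p679160): `U₁₄ = U₁₅ = 0`, so **`[t⁴⁴]S₂ = ū₁U₁₄² + ū₁²U₁₄ = 0` on every class** —
  `NonDeg(2) ⟺ one of [t⁴⁸], [t⁵²], [t⁵⁶], [t⁶⁰] ≠ 0` (`levelTwo_nonDeg_support`).

References: the card (J4, J5); [SilvermanAEC2009] IV.1 for context only.
-/

set_option autoImplicit false
-- the Theorems namespace of this sub repeats the summit name by design (D-0017 nested layout)
set_option linter.dupNamespace false

noncomputable section

open PowerSeries Finset
open Summit.BirchSwinnertonDyer.BirchSwinnertonDyer.Theorems.SignedMuAtTwo.Tilt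

namespace Summit.BirchSwinnertonDyer.BirchSwinnertonDyer.Theorems.SignedMuAtTwo.JetCharacterSums

variable {k : Type*} [CommRing k] [CharP k 2]

section Wall

variable {S δ ε : PowerSeries k} {u c : k} {N v e : ℕ}

include S δ ε u c N v e in
/-- **The wall below the threshold, relaxed ranges** (same closed form as `coeff_levelStep_belowThreshold`, p679704, without `N ≤ v + 2` and
for the wider zone `e + 5 ≤ 4N + v`, `e ≤ 2N + 2v + 1`): e.g. level `1` (`N = v = 4`) now reaches `e = 15`. [folklore] -/
theorem coeff_levelStep_belowThreshold' (hN : 1 ≤ N) (hR : d⁄dX k S = S * S) (hv : (v : ℕ∞) ≤ S.order) (hv2 : 2 ≤ v)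
    (hδ : δ = C u * X ^ N + C c * X ^ (2 * N) + X ^ (2 * N + 2) * ε) (h2N : 2 * N ≤ e) (he1 : e + 5 ≤ 4 * N + v)
    (he2 : e ≤ 2 * N + 2 * v + 1) :
    coeff e (S + S.subst (X + δ)) =
      u * coeff (e - N) (S * S) + c * coeff (e - 2 * N) (S * S) +
        u ^ 2 * ((((e - 2 * N + 2).choose 2 : ℕ) : k) * coeff (e - 2 * N + 2) S) +
        u ^ 3 * ((((e + 3 - 3 * N).choose 3 : ℕ) : k) * coeff (e + 3 - 3 * N) S) := by
  have h2P := two_eq_zero_powerSeries (k := k)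
  -- `δ = ū t^N + t^{2N} θ`, `θ = c + t²ε'`
  set θ : PowerSeries k := C c + X ^ 2 * ε with hθ
  have hδθ : δ = C u * X ^ N + X ^ (2 * N) * θ := by rw [hδ, hθ]; ring
  have hδord : (N : ℕ∞) ≤ δ.order := by
    rw [hδθ]
    refine le_order_add_of_le ?_ ?_
    · have := le_order_mul_of_le (show ((0 : ℕ) : ℕ∞) ≤ (C u : PowerSeries k).order by simp) (le_order_X_pow (k := k) N)
      simpa using this
    · have := le_order_mul_of_le (le_order_X_pow (k := k) (2 * N)) (show ((0 : ℕ) : ℕ∞) ≤ θ.order by simp)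
      exact le_trans (by exact_mod_cast (by omega)) this
  have hT := le_order_taylorRemainder₃ hN hδord hv
  set R : PowerSeries k := S.subst (X + δ) - S - d⁄dX k S * δ -
    (PowerSeries.mk fun n => (((n + 2).choose 2 : ℕ) : k) * coeff (n + 2) S) * δ ^ 2 -
    (PowerSeries.mk fun n => (((n + 3).choose 3 : ℕ) : k) * coeff (n + 3) S) * δ ^ 3 with hRdef
  have hsum : S + S.subst (X + δ) = S * S * δ +
      (PowerSeries.mk fun n => (((n + 2).choose 2 : ℕ) : k) * coeff (n + 2) S) * δ ^ 2 +
      (PowerSeries.mk fun n => (((n + 3).choose 3 : ℕ) : k) * coeff (n + 3) S) * δ ^ 3 + R := by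
    rw [hRdef, ← hR]; linear_combination Tilt.add_self_eq_zero S
  -- powers of `δ` in characteristic `2`
  have hδsq : δ ^ 2 = C u ^ 2 * X ^ (2 * N) + X ^ (4 * N) * θ ^ 2 := by
    rw [hδθ, show 4 * N = 2 * (2 * N) from by ring, pow_mul, pow_mul]
    linear_combination (C u * X ^ N * (X ^ (2 * N) * θ)) * h2P
  have hδcube : δ ^ 3 = C u ^ 3 * X ^ (3 * N) + X ^ (4 * N) * (C u ^ 2 * θ + C u * X ^ N * θ ^ 2 + X ^ (2 * N) * θ ^ 3) := by
    rw [pow_succ, hδsq, hδθ, show 4 * N = 2 * (2 * N) from by ring, show 3 * N = 2 * N + N from by ring, pow_add, pow_mul]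
    ring
  rw [hsum, hδsq, hδcube, map_add, map_add, map_add]
  have hSS : ((2 * v : ℕ) : ℕ∞) ≤ (S * S).order := by
    have := le_order_mul_of_le hv hv; rwa [show v + v = 2 * v by ring] at this
  -- (1) `S²·δ`
  have hA : coeff e (S * S * δ) = u * coeff (e - N) (S * S) + c * coeff (e - 2 * N) (S * S) := by
    rw [hδθ, hθ, mul_add, mul_add, mul_add, map_add, map_add,
      show S * S * (C u * X ^ N) = C u * (X ^ N * (S * S)) by ring, coeff_C_mul, coeff_X_pow_mul', if_pos (by omega),
      show S * S * (X ^ (2 * N) * C c) = C c * (X ^ (2 * N) * (S * S)) by ring, coeff_C_mul, coeff_X_pow_mul', if_pos h2N,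
      show S * S * (X ^ (2 * N) * (X ^ 2 * ε)) = X ^ (2 * N + 2) * (S * S * ε) by ring, coeff_X_pow_mul']
    have hz : coeff (e - (2 * N + 2)) (S * S * ε) = 0 :=
      coeff_of_lt_order _ (lt_of_lt_of_le (by exact_mod_cast (by omega))
        (le_order_mul_of_le hSS (show ((0 : ℕ) : ℕ∞) ≤ ε.order by simp)))
    rw [hz]; split_ifs <;> ring
  -- (2) `H₂S·δ²`
  have hH2ord : (((v - 2 : ℕ)) : ℕ∞) ≤ (PowerSeries.mk fun n => (((n + 2).choose 2 : ℕ) : k) * coeff (n + 2) S).order := by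
    refine nat_le_order _ _ fun j hj => ?_
    rw [coeff_mk, coeff_of_lt_order (j + 2) (lt_of_lt_of_le (by exact_mod_cast (by omega)) hv), mul_zero]
  have hB : coeff e ((PowerSeries.mk fun n => (((n + 2).choose 2 : ℕ) : k) * coeff (n + 2) S) *
      (C u ^ 2 * X ^ (2 * N) + X ^ (4 * N) * θ ^ 2)) =
      u ^ 2 * ((((e - 2 * N + 2).choose 2 : ℕ) : k) * coeff (e - 2 * N + 2) S) := by
    rw [mul_add, map_add, ← map_pow,
      show (PowerSeries.mk fun n => (((n + 2).choose 2 : ℕ) : k) * coeff (n + 2) S) * (C (u ^ 2) * X ^ (2 * N)) =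
        C (u ^ 2) * (X ^ (2 * N) * PowerSeries.mk fun n => (((n + 2).choose 2 : ℕ) : k) * coeff (n + 2) S) by ring,
      coeff_C_mul, coeff_X_pow_mul', if_pos h2N, coeff_mk,
      show (PowerSeries.mk fun n => (((n + 2).choose 2 : ℕ) : k) * coeff (n + 2) S) * (X ^ (4 * N) * θ ^ 2) =
        X ^ (4 * N) * ((PowerSeries.mk fun n => (((n + 2).choose 2 : ℕ) : k) * coeff (n + 2) S) * θ ^ 2) by ring,
      coeff_X_pow_mul']
    split_ifs with h4N
    · rw [coeff_of_lt_order _ (lt_of_lt_of_le (by exact_mod_cast (by omega))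
        (le_order_mul_of_le hH2ord (show ((0 : ℕ) : ℕ∞) ≤ (θ ^ 2).order by simp))), add_zero]
    · rw [add_zero]
  -- (3) `H₃S·δ³`
  have hH3ord : (((v - 3 : ℕ)) : ℕ∞) ≤ (PowerSeries.mk fun n => (((n + 3).choose 3 : ℕ) : k) * coeff (n + 3) S).order := by
    refine nat_le_order _ _ fun j hj => ?_
    rw [coeff_mk, coeff_of_lt_order (j + 3) (lt_of_lt_of_le (by exact_mod_cast (by omega)) hv), mul_zero]
  have hC4 : coeff e (X ^ (4 * N) * ((PowerSeries.mk fun n => (((n + 3).choose 3 : ℕ) : k) * coeff (n + 3) S) *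
      (C u ^ 2 * θ + C u * X ^ N * θ ^ 2 + X ^ (2 * N) * θ ^ 3))) = 0 := by
    rw [coeff_X_pow_mul']
    split_ifs with h4N
    · exact coeff_of_lt_order _ (lt_of_lt_of_le (by exact_mod_cast (by omega))
        (le_order_mul_of_le hH3ord (show ((0 : ℕ) : ℕ∞) ≤ (C u ^ 2 * θ + C u * X ^ N * θ ^ 2 + X ^ (2 * N) * θ ^ 3).order by simp)))
    · rfl
  have hC3 : coeff e (C (u ^ 3) * (X ^ (3 * N) * PowerSeries.mk fun n => (((n + 3).choose 3 : ℕ) : k) * coeff (n + 3) S)) =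
      u ^ 3 * ((((e + 3 - 3 * N).choose 3 : ℕ) : k) * coeff (e + 3 - 3 * N) S) := by
    rw [coeff_C_mul, coeff_X_pow_mul']
    split_ifs with h3N
    · rw [coeff_mk, show e - 3 * N + 3 = e + 3 - 3 * N by omega]
    · rw [Nat.choose_eq_zero_of_lt (by omega : e + 3 - 3 * N < 3), Nat.cast_zero, zero_mul, mul_zero]
  have hC' : coeff e ((PowerSeries.mk fun n => (((n + 3).choose 3 : ℕ) : k) * coeff (n + 3) S) *
      (C u ^ 3 * X ^ (3 * N) + X ^ (4 * N) * (C u ^ 2 * θ + C u * X ^ N * θ ^ 2 + X ^ (2 * N) * θ ^ 3))) =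
      u ^ 3 * ((((e + 3 - 3 * N).choose 3 : ℕ) : k) * coeff (e + 3 - 3 * N) S) := by
    rw [mul_add, map_add, ← map_pow,
      show (PowerSeries.mk fun n => (((n + 3).choose 3 : ℕ) : k) * coeff (n + 3) S) * (C (u ^ 3) * X ^ (3 * N)) =
        C (u ^ 3) * (X ^ (3 * N) * PowerSeries.mk fun n => (((n + 3).choose 3 : ℕ) : k) * coeff (n + 3) S) by ring,
      hC3,
      show (PowerSeries.mk fun n => (((n + 3).choose 3 : ℕ) : k) * coeff (n + 3) S) *
          (X ^ (4 * N) * (C u ^ 2 * θ + C u * X ^ N * θ ^ 2 + X ^ (2 * N) * θ ^ 3)) =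
        X ^ (4 * N) * ((PowerSeries.mk fun n => (((n + 3).choose 3 : ℕ) : k) * coeff (n + 3) S) *
          (C u ^ 2 * θ + C u * X ^ N * θ ^ 2 + X ^ (2 * N) * θ ^ 3)) by ring,
      hC4, add_zero]
  -- (4) the remainder
  have hlt : ((e : ℕ) : ℕ∞) < ((4 * N + v - 4 : ℕ) : ℕ∞) := by exact_mod_cast (by omega)
  have hD : coeff e R = 0 := coeff_of_lt_order _ (lt_of_lt_of_le hlt hT)
  rw [hA, hB, hC', hD, add_zero]

end Wall

section LevelOne

variable {S δ ε : PowerSeries k} {u c : k}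

/-- **The level-one wall, sharp: `[t¹⁴]S₁ = [t¹⁵]S₁ = 0`** for `S₁ = S₀ + S₀(t + δ₀)` with `S₀' = S₀²`, `T₀ = T₂ = 0`, `δ₀ = ūt⁴ + ct⁸ + t¹⁰ε'`
(so with p678286: `S₁ ≡ (ūT₄² + ū²T₆)t¹² (mod t¹⁶)`, and `U₁₄ = U₁₅ = 0` feed `levelTwo_wall`: `[t⁴⁴]S₂ = 0`). [folklore] -/
theorem levelOne_wall_sharp (hR : d⁄dX k S = S * S) (h0 : coeff 0 S = 0) (h2 : coeff 2 S = 0)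
    (hδ : δ = C u * X ^ 4 + C c * X ^ (2 * 4) + X ^ (2 * 4 + 2) * ε) :
    coeff 14 (S + S.subst (X + δ)) = 0 ∧ coeff 15 (S + S.subst (X + δ)) = 0 := by
  have h1 := coeff_one_eq_zero_of_riccati hR h0
  have h3 := coeff_three_eq_zero_of_riccati hR h0
  have h5 := coeff_five_eq_zero_of_riccati hR h0 h2
  have hv : ((4 : ℕ) : ℕ∞) ≤ S.order := nat_le_order _ _ fun i hi => by
    interval_cases i <;> assumption
  have h2k : (2 : k) = 0 := CharTwo.two_eq_zero
  refine ⟨?_, ?_⟩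
  · rw [coeff_levelStep_belowThreshold' (by norm_num) hR hv (by norm_num) hδ (by norm_num) (by norm_num) (by norm_num),
      show 14 - 4 = 2 * 5 from rfl, coeff_mul_self_two_mul, show 14 - 2 * 4 = 2 * 3 from rfl, coeff_mul_self_two_mul,
      show 2 * 3 + 2 = 8 from rfl, show 14 + 3 - 3 * 4 = 5 from rfl, h3, h5,
      show Nat.choose 8 2 = 2 * 14 from by norm_num [Nat.choose_two_right]]
    push_cast
    linear_combination (u ^ 2 * 14 * coeff 8 S) * h2k
  · rw [coeff_levelStep_belowThreshold' (by norm_num) hR hv (by norm_num) hδ (by norm_num) (by norm_num) (by norm_num),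
      show 15 - 4 = 2 * 5 + 1 from rfl, coeff_mul_self_of_odd, show 15 - 2 * 4 = 2 * 3 + 1 from rfl, coeff_mul_self_of_odd,
      show 2 * 3 + 1 + 2 = 9 from rfl, show 15 + 3 - 3 * 4 = 6 from rfl,
      show Nat.choose 9 2 = 2 * 18 from by norm_num [Nat.choose_two_right], show Nat.choose 6 3 = 2 * 10 from by decide]
    push_cast
    linear_combination (u ^ 2 * 18 * coeff 9 S + u ^ 3 * 10 * coeff 6 S) * h2k

/-- **`NonDeg(2)` support**: after degenerate levels `0` and `1`, with `U₁₄ = 0` (from `levelOne_wall_sharp`), `S₁' = S₁²`, `ord S₁ ≥ 14`,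
`δ₁ = ū₁t¹⁶ + c₁t³² + t³⁴ε'`: `[t⁴⁴]S₂ = 0` and `[t⁶⁰]S₂ = ū₁U₂₂² + ū₁²U₃₀` — so `v(S₂) < 62` iff one of
`ū₁U₁₆² + ū₁²U₁₈`, `ū₁U₁₈² + ū₁²U₂₂`, `ū₁U₂₀² + ū₁²U₂₆`, `ū₁U₂₂² + ū₁²U₃₀` is non-zero (the other coefficients below `62` vanish).
[folklore] -/
theorem levelTwo_nonDeg_support (hR : d⁄dX k S = S * S) (hv : ((14 : ℕ) : ℕ∞) ≤ S.order) (h14 : coeff 14 S = 0)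
    (hδ : δ = C u * X ^ 16 + C c * X ^ (2 * 16) + X ^ (2 * 16 + 2) * ε) :
    coeff 44 (S + S.subst (X + δ)) = 0 ∧ coeff 60 (S + S.subst (X + δ)) = u * coeff 22 S ^ 2 + u ^ 2 * coeff 30 S := by
  have hδ' : δ = C u * X ^ 16 + X ^ (2 * 16) * (C c + X ^ 2 * ε) := by rw [hδ]; ring
  refine ⟨?_, ?_⟩
  · rw [(levelTwo_wall hR hv hδ').1, h14]; ring
  · rw [(levelTwo_wall_complete hR hv hδ).2.1, h14]; ring

end LevelOne

end Summit.BirchSwinnertonDyer.BirchSwinnertonDyer.Theorems.SignedMuAtTwo.JetCharacterSums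

end
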